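import Literature.AnabelianGeometry.EtaleTheta.SettingModelBTorsionTowerLevels
import HarnessLib

/-!
# The b-torsion tower — comparison `ι_n`, transport of (PBF), projection to `C_n`, decomposition (ROUTE-PBF file T0-P2)

PROOF-ONLY.  `permHat_one/_mul`, `forall_mem_closure_permHat_eq`, `iota_injective_and_range`, `affHat_iota`,
`mem_closure_fixedLetters_of_PBF(')`, `N̂` lemmas, `exists_projC`, `aff_eq_conj`/`affHat_eq_conj`, `exists_decomp_fixed`.
Classical profinite group theory about OUR semi-synthetic `F₂hatT`; CONDITIONAL (where stated) on the displayed
tree-free hypothesis `PermBasisFixedPoints`; nothing about [EtTh]/[IUTchII]/[IUTchIII] in print; no side on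
[IUTchIII] Cor 3.12; nothing here asserts abc proved or refuted.  abc-iut-L6-t19 gen 22 (ROUTE-PBF, rung (L3′) slice 1).
-/

noncomputable section

namespace Literature.AnabelianGeometry.EtaleTheta.SettingModel.BTorsionTower

open Literature.AnabelianGeometry.EtaleTheta.SettingModel
open Literature.AnabelianGeometry.EtaleTheta (ZHatLevel.level ZHatLevel.levelChar)
open Literature.AnabelianGeometry.SemiGraphs
open Literature.AnabelianGeometry.AbsoluteAnabelian
open Literature.IUT.HodgeTheaters (profiniteCompletion toCompletion)
open CategoryTheory
open Literature.AnabelianGeometry.EtaleTheta.SettingModel.TreeFree (permHat PermBasisFixedPoints permHat_toCompletion)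

section Transport

/-- `permHat σ` is continuous (local copy; the P-chain's defs file may or may not export it). [cite: MochizukiEtTh2009, §1 p.12] -/
theorem continuous_permHat' {S : Type} (σ : Equiv.Perm S) : Continuous (permHat.{0} σ) :=
  (ProfiniteGrp.profiniteCompletion.map (GrpCat.ofHom (FreeGroup.map σ))).hom.continuous_toFun

/-- `permHat 1 = id`. [cite: MochizukiEtTh2009, §1 p.12] -/
theorem permHat_one {S : Type} (w : profiniteCompletion (FreeGroup S)) : permHat (1 : Equiv.Perm S) w = w := by
  have h : (permHat (1 : Equiv.Perm S) : _ → _) = id := by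
    refine Literature.IUT.HodgeTheaters.ProfiniteCompletion.eq_of_forall_toCompletion
      (continuous_permHat' 1) continuous_id fun g => ?_
    rw [permHat_toCompletion, id]
    congr 1
    rw [Equiv.Perm.coe_one]
    exact FreeGroup.map.id' g
  exact congrFun h w

/-- `permHat (σ τ) = permHat σ ∘ permHat τ`. [cite: MochizukiEtTh2009, §1 p.12] -/
theorem permHat_mul {S : Type} (σ τ : Equiv.Perm S) (w : profiniteCompletion (FreeGroup S)) :
    permHat (σ * τ) w = permHat σ (permHat τ w) := by
  have h : (permHat (σ * τ) : _ → _) = fun x => permHat σ (permHat τ x) := by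
    refine Literature.IUT.HodgeTheaters.ProfiniteCompletion.eq_of_forall_toCompletion
      (continuous_permHat' _) ((continuous_permHat' σ).comp (continuous_permHat' τ)) fun g => ?_
    rw [permHat_toCompletion, permHat_toCompletion, permHat_toCompletion]
    congr 1
    change FreeGroup.map (⇑σ ∘ ⇑τ) g = FreeGroup.map σ (FreeGroup.map τ g)
    rw [← FreeGroup.map.comp]
  exact congrFun h w

/-- The set of permutations fixing `w` is closed under the group operations: fixedness by a generating set
gives fixedness by the generated subgroup. [cite: MochizukiEtTh2009, §1 p.12] -/
theorem forall_mem_closure_permHat_eq {S : Type} (T : Set (Equiv.Perm S))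
    (w : profiniteCompletion (FreeGroup S)) (h : ∀ σ ∈ T, permHat σ w = w) :
    ∀ σ ∈ Subgroup.closure T, permHat σ w = w := by
  intro σ hσ
  induction hσ using Subgroup.closure_induction with
  | mem x hx => exact h x hx
  | one => exact permHat_one w
  | mul x y _ _ hx hy => rw [permHat_mul, hy, hx]
  | inv x _ hx =>
      have h1 : permHat x⁻¹ (permHat x w) = w := by rw [← permHat_mul, inv_mul_cancel, permHat_one]
      rwa [hx] at h1

variable (n : ℕ+)

/-- `F̂(ZMod n) ≅ Ĝ_let` (completion of the abstract iso `FreeGroup ≃ inl.range`), composed with the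
comparison: gives injectivity and range of `ι_n`. [cite: MochizukiEtTh2009, §1 p.12] -/
theorem iota_injective_and_range :
    Function.Injective (iota n) ∧ Set.range (iota n) = Nhat n := by
  haveI : (Glet n).FiniteIndex := finiteIndex_Glet n
  -- the iso `e : FreeGroup ≃* Glet` and its inverse on completions
  let e : FreeGroup (ZMod n) ≃* Glet n := MonoidHom.ofInjective SemidirectProduct.inl_injective
  let mE : profiniteCompletion (FreeGroup (ZMod n)) →ₜ* profiniteCompletion (Glet n) :=
    (ProfiniteGrp.profiniteCompletion.map (GrpCat.ofHom e.toMonoidHom)).hom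
  let mE' : profiniteCompletion (Glet n) →ₜ* profiniteCompletion (FreeGroup (ZMod n)) :=
    (ProfiniteGrp.profiniteCompletion.map (GrpCat.ofHom e.symm.toMonoidHom)).hom
  have hEE' : ∀ x, mE (mE' x) = x := fun x => by
    have h := ProfiniteGrp.profiniteCompletion.map_comp (GrpCat.ofHom e.symm.toMonoidHom)
      (GrpCat.ofHom e.toMonoidHom)
    rw [← GrpCat.ofHom_comp, show e.toMonoidHom.comp e.symm.toMonoidHom = MonoidHom.id _ from
      MonoidHom.ext fun y => e.apply_symm_apply y, GrpCat.ofHom_id,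
      CategoryTheory.Functor.map_id] at h
    have h' := congrArg (fun f => (ProfiniteGrp.Hom.hom f) x) h
    exact h'.symm
  -- ψ := ι ∘ mE' : completion Glet → Q n extends the inclusion
  let ψ : profiniteCompletion (Glet n) →* profiniteCompletion (Lam n) :=
    (iota n).toMonoidHom.comp mE'.toMonoidHom
  have hψc : Continuous ψ := (iota n).continuous.comp mE'.continuous
  have hψ : ∀ g : Glet n, ψ (toCompletion (Glet n) g) = toCompletion (Lam n) (g : Lam n) := by
    intro g
    change iota n (mE' (toCompletion (Glet n) g)) = _
    rw [show mE' (toCompletion (Glet n) g) = toCompletion _ (e.symm g) from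
      Literature.IUT.HodgeTheaters.ProfiniteCompletion.profiniteCompletionMap_toCompletion _ g,
      iota_toCompletion]
    congr 1
    exact MonoidHom.apply_ofInjective_symm SemidirectProduct.inl_injective g
  obtain ⟨hinj, hrange⟩ :=
    Literature.IUT.HodgeTheaters.ProfiniteCompletion.injective_and_range_eq_closure_of_toCompletion
      (Glet n) (ψ := ψ) hψc hψ
  -- transfer along the bijection `mE'`
  have hsurj' : Function.Surjective mE' := fun y => ⟨mE y, by
    have h := ProfiniteGrp.profiniteCompletion.map_comp (GrpCat.ofHom e.toMonoidHom)
      (GrpCat.ofHom e.symm.toMonoidHom)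
    rw [← GrpCat.ofHom_comp, show e.symm.toMonoidHom.comp e.toMonoidHom = MonoidHom.id _ from
      MonoidHom.ext fun y => e.symm_apply_apply y, GrpCat.ofHom_id,
      CategoryTheory.Functor.map_id] at h
    have h' := congrArg (fun f => (ProfiniteGrp.Hom.hom f) y) h
    exact h'.symm⟩
  constructor
  · intro x y hxy
    obtain ⟨x', rfl⟩ := hsurj' x
    obtain ⟨y', rfl⟩ := hsurj' y
    have : x' = y' := hinj hxy
    rw [this]
  · ext z
    change z ∈ Set.range (iota n) ↔ z ∈ closure (toCompletion (Lam n) '' (Glet n : Set (Lam n)))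
    rw [← hrange]
    constructor
    · rintro ⟨x, rfl⟩
      obtain ⟨x', rfl⟩ := hsurj' x
      exact ⟨x', rfl⟩
    · rintro ⟨x', rfl⟩
      exact ⟨mE' x', rfl⟩

/-- **Intertwining**: `k̂_{u,β} ∘ ι_n = ι_n ∘ permHat (affPerm u β)`. [cite: MochizukiEtTh2009, §1 p.12] -/
theorem affHat_iota (u : (ZMod n)ˣ) (β : ZMod n) (w : profiniteCompletion (FreeGroup (ZMod n))) :
    affHat n u β (iota n w) = iota n (permHat (affPerm n u β) w) := by
  have h : (fun x => affHat n u β (iota n x)) = fun x => iota n (permHat (affPerm n u β) x) := by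
    refine Literature.IUT.HodgeTheaters.ProfiniteCompletion.eq_of_forall_toCompletion
      ((affHat n u β).continuous.comp (iota n).continuous)
      ((iota n).continuous.comp (continuous_permHat' _)) fun g => ?_
    rw [iota_toCompletion, affHat_etaL, permHat_toCompletion, iota_toCompletion]
    congr 1
    have : (affLetters n u β) = FreeGroup.map (affPerm n u β) :=
      FreeGroup.ext_hom _ _ fun i => by rw [affLetters_of, FreeGroup.map.of, affPerm_apply]
    change aff n u β (SemidirectProduct.inl g) = SemidirectProduct.inl (FreeGroup.map (affPerm n u β) g)
    ext <;> simp [aff, this]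
  exact congrFun h w

/-- **(PBF) transported into `Q_n`**: an element of `N̂` fixed by the `k̂_{u,0}`, `u ∈ U` (units), lies in
the closure of `η_Λ(inl ⟨x_i : u·i = i ∀ u ∈ U⟩)`. [cite: MochizukiEtTh2009, §1 p.12] -/
theorem mem_closure_fixedLetters_of_PBF (hPBF : PermBasisFixedPoints.{0}) (U : Set (ZMod n)ˣ)
    {ν : Q n} (hν : ν ∈ Nhat n) (hfix : ∀ u ∈ U, affHat n u 0 ν = ν) :
    ν ∈ closure (etaL n '' (SemidirectProduct.inl ''
      (Subgroup.closure (FreeGroup.of '' {i : ZMod n | ∀ u ∈ U, (u : ZMod n) * i = i}) :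
        Set (FreeGroup (ZMod n))))) := by
  obtain ⟨hinj, hrange⟩ := iota_injective_and_range n
  have hν' : ν ∈ Set.range (iota n) := by rw [hrange]; exact hν
  obtain ⟨w, rfl⟩ := hν'
  -- `w` is fixed by the affine permutations
  let T : Set (Equiv.Perm (ZMod n)) := (fun u => affPerm n u 0) '' U
  have hT : ∀ σ ∈ T, permHat σ w = w := by
    rintro σ ⟨u, hu, rfl⟩
    apply hinj
    rw [← affHat_iota, hfix u hu]
  have hQ := forall_mem_closure_permHat_eq T w hT
  have hw := hPBF (ZMod n) (Subgroup.closure T) w hQ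
  -- the fixed letters of `closure T` are the `i` with `u i = i`
  have hletters : {s : ZMod n | ∀ σ ∈ Subgroup.closure T, σ s = s} ⊆ {i | ∀ u ∈ U, (u : ZMod n) * i = i} := by
    intro s hs u hu
    have h := hs (affPerm n u 0) (Subgroup.subset_closure ⟨u, hu, rfl⟩)
    simpa using h
  have hmono : (Subgroup.closure (FreeGroup.of '' {s : ZMod n | ∀ σ ∈ Subgroup.closure T, σ s = s}) :
      Set (FreeGroup (ZMod n))) ⊆
      (Subgroup.closure (FreeGroup.of '' {i : ZMod n | ∀ u ∈ U, (u : ZMod n) * i = i}) : Set _) :=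
    Subgroup.closure_mono (Set.image_mono hletters)
  have hw' : w ∈ closure (toCompletion (FreeGroup (ZMod n)) ''
      (Subgroup.closure (FreeGroup.of '' {i : ZMod n | ∀ u ∈ U, (u : ZMod n) * i = i}) : Set _)) :=
    closure_mono (Set.image_mono hmono) hw
  -- push forward along the continuous `ι_n`
  have himg := image_closure_subset_closure_image (iota n).continuous ⟨w, hw', rfl⟩
  refine closure_mono ?_ himg
  rintro _ ⟨_, ⟨g, hg, rfl⟩, rfl⟩
  exact ⟨SemidirectProduct.inl g, ⟨g, hg, rfl⟩, (iota_toCompletion n g).symm⟩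

end Transport


section Structure

variable (n : ℕ+)

/-- `η_Λ(inl g) ∈ N̂`. [cite: MochizukiEtTh2009, §1 p.12] -/
theorem etaL_inl_mem_NhatSub (g : FreeGroup (ZMod n)) : etaL n (SemidirectProduct.inl g) ∈ NhatSub n :=
  Subgroup.le_topologicalClosure _ ⟨SemidirectProduct.inl g, ⟨g, rfl⟩, rfl⟩

/-- `N̂` is stable under conjugation by `η_Λ(inr c)`. [cite: MochizukiEtTh2009, §1 p.12] -/
theorem conj_inr_mem_NhatSub (c : Multiplicative (ZMod n)) {ν : Q n} (hν : ν ∈ NhatSub n) :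
    (etaL n (SemidirectProduct.inr c))⁻¹ * ν * etaL n (SemidirectProduct.inr c) ∈ NhatSub n := by
  -- conjugation by a fixed element is continuous and maps `η_Λ(G)` into itself
  have hG : ∀ g ∈ (Glet n).map (etaL n),
      (etaL n (SemidirectProduct.inr c))⁻¹ * g * etaL n (SemidirectProduct.inr c) ∈ (Glet n).map (etaL n) := by
    rintro _ ⟨g, ⟨w, rfl⟩, rfl⟩
    refine ⟨(SemidirectProduct.inr c)⁻¹ * SemidirectProduct.inl w * SemidirectProduct.inr c,
      ⟨((rot n c)⁻¹) w, by rw [SemidirectProduct.inl_aut_inv, map_inv]⟩, by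
      rw [map_mul, map_mul, map_inv]⟩
  have hcont : Continuous fun x : Q n =>
      (etaL n (SemidirectProduct.inr c))⁻¹ * x * etaL n (SemidirectProduct.inr c) :=
    (continuous_const.mul continuous_id).mul continuous_const
  have himg := image_closure_subset_closure_image hcont
    (s := ((Glet n).map (etaL n) : Set (Q n))) ⟨ν, by rwa [← Subgroup.topologicalClosure_coe], rfl⟩
  rw [← SetLike.mem_coe, Subgroup.topologicalClosure_coe]
  refine closure_mono ?_ himg
  rintro _ ⟨g, hg, rfl⟩
  exact hG g hg

/-- `k̂_{u,β}` preserves `N̂`. [cite: MochizukiEtTh2009, §1 p.12] -/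
theorem affHat_mem_NhatSub (u β : ZMod n) {ν : Q n} (hν : ν ∈ NhatSub n) : affHat n u β ν ∈ NhatSub n := by
  have himg := image_closure_subset_closure_image (affHat n u β).continuous
    (s := ((Glet n).map (etaL n) : Set (Q n))) ⟨ν, by rwa [← Subgroup.topologicalClosure_coe], rfl⟩
  rw [← SetLike.mem_coe, Subgroup.topologicalClosure_coe]
  refine closure_mono ?_ himg
  rintro _ ⟨_, ⟨_, ⟨w, rfl⟩, rfl⟩, rfl⟩
  refine ⟨SemidirectProduct.inl (affLetters n u β w), ⟨_, rfl⟩, ?_⟩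
  change etaL n (SemidirectProduct.inl (affLetters n u β w)) = affHat n u β (etaL n (SemidirectProduct.inl w))
  rw [affHat_etaL]
  congr 1
  ext <;> simp [aff]

/-- The projection `π : Q_n → C_n` (continuous extension of `Λ_n → C_n`), with its three properties:
`π ∘ η_Λ = rightHom`, `π(N̂) = 1`, `π ∘ k̂_{u,β} = (c ↦ c^u) ∘ π`. [cite: MochizukiEtTh2009, §1 p.12] -/
theorem exists_projC : ∃ π : Q n →* Multiplicative (ZMod n),
    (∀ g : Lam n, π (etaL n g) = SemidirectProduct.rightHom g) ∧
    (∀ ν ∈ NhatSub n, π ν = 1) ∧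
    (∀ (u β : ZMod n) (x : Q n), π (affHat n u β x) = affRot n u (π x)) := by
  obtain ⟨π, hπη, -, hπc⟩ := Literature.IUT.HodgeTheaters.ProfiniteCompletion.exists_lift_of_finite
    (SemidirectProduct.rightHom : Lam n →* Multiplicative (ZMod n))
  have hcont : Continuous π := hπc
  refine ⟨π, hπη, ?_, ?_⟩
  · intro ν hν
    have hcl : IsClosed ((π : Q n → _) ⁻¹' {1}) := (isClosed_discrete _).preimage hcont
    have hsub : ((Glet n).map (etaL n) : Set (Q n)) ⊆ (π : Q n → _) ⁻¹' {1} := by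
      rintro _ ⟨g, ⟨w, rfl⟩, rfl⟩
      change π (etaL n (SemidirectProduct.inl w)) ∈ ({1} : Set _)
      rw [hπη, SemidirectProduct.rightHom_inl]; rfl
    have h := (hcl.closure_subset_iff).2 hsub
    rw [← Subgroup.topologicalClosure_coe] at h
    exact h hν
  · intro u β x
    have h : (fun x => π (affHat n u β x)) = fun x => affRot n u (π x) := by
      refine Literature.IUT.HodgeTheaters.ProfiniteCompletion.eq_of_forall_toCompletion
        (hcont.comp (affHat n u β).continuous) (continuous_of_discreteTopology.comp hcont) fun g => ?_
      change π (affHat n u β (etaL n g)) = affRot n u (π (etaL n g))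
      rw [affHat_etaL, hπη, hπη]
      rfl
    exact congrFun h x

end Structure


section AffineTools

variable (n : ℕ+)

/-- `k_{u,β} = Inn(c^β) ∘ k_{u,0}` on `Λ_n`. [cite: MochizukiEtTh2009, §1 p.12] -/
theorem aff_eq_conj (u β : ZMod n) (g : Lam n) :
    aff n u β g = SemidirectProduct.inr (Multiplicative.ofAdd β) * aff n u 0 g *
      (SemidirectProduct.inr (Multiplicative.ofAdd β))⁻¹ := by
  have h : aff n u β = (MulAut.conj (SemidirectProduct.inr (Multiplicative.ofAdd β) : Lam n)).toMonoidHom.comp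
      (aff n u 0) := by
    refine SemidirectProduct.hom_ext ?_ ?_
    · refine FreeGroup.ext_hom _ _ fun i => ?_
      simp only [MonoidHom.coe_comp, Function.comp_apply, MulEquiv.coe_toMonoidHom, MulAut.conj_apply]
      change aff n u β (xL n i) = _ * aff n u 0 (xL n i) * _
      rw [aff_xL, aff_xL, add_zero, conj_xL]
    · ext c <;> simp [aff]
  exact DFunLike.congr_fun h g

/-- `k̂_{u,β} = Inn(η(c^β)) ∘ k̂_{u,0}` on `Q_n`. [cite: MochizukiEtTh2009, §1 p.12] -/
theorem affHat_eq_conj (u β : ZMod n) (y : Q n) :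
    affHat n u β y = etaL n (SemidirectProduct.inr (Multiplicative.ofAdd β)) * affHat n u 0 y *
      (etaL n (SemidirectProduct.inr (Multiplicative.ofAdd β)))⁻¹ := by
  have h : (affHat n u β : Q n → Q n) = fun y =>
      etaL n (SemidirectProduct.inr (Multiplicative.ofAdd β)) * affHat n u 0 y *
        (etaL n (SemidirectProduct.inr (Multiplicative.ofAdd β)))⁻¹ := by
    refine Literature.IUT.HodgeTheaters.ProfiniteCompletion.eq_of_forall_toCompletion
      (affHat n u β).continuous ((continuous_const.mul (affHat n u 0).continuous).mul continuous_const) fun g => ?_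
    change affHat n u β (etaL n g) = _ * affHat n u 0 (etaL n g) * _
    rw [affHat_etaL, affHat_etaL, aff_eq_conj, map_mul, map_mul, map_inv]
  exact congrFun h y

/-- **(PBF) transported, affine form**: an element of `N̂` fixed by the `k̂_{u,β}`, `(u,β) ∈ T`, lies in the
closure of `η_Λ(inl ⟨x_i : u·i + β = i ∀ (u,β) ∈ T⟩)`. [cite: MochizukiEtTh2009, §1 p.12] -/
theorem mem_closure_fixedLetters_of_PBF' (hPBF : PermBasisFixedPoints.{0}) (T : Set ((ZMod n)ˣ × ZMod n))
    {ν : Q n} (hν : ν ∈ Nhat n) (hfix : ∀ t ∈ T, affHat n t.1 t.2 ν = ν) :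
    ν ∈ closure (etaL n '' (SemidirectProduct.inl ''
      (Subgroup.closure (FreeGroup.of '' {i : ZMod n | ∀ t ∈ T, (t.1 : ZMod n) * i + t.2 = i}) :
        Set (FreeGroup (ZMod n))))) := by
  obtain ⟨hinj, hrange⟩ := iota_injective_and_range n
  have hν' : ν ∈ Set.range (iota n) := by rw [hrange]; exact hν
  obtain ⟨w, rfl⟩ := hν'
  let Tp : Set (Equiv.Perm (ZMod n)) := (fun t => affPerm n t.1 t.2) '' T
  have hT : ∀ σ ∈ Tp, permHat σ w = w := by
    rintro σ ⟨t, ht, rfl⟩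
    apply hinj
    rw [← affHat_iota, hfix t ht]
  have hQ := forall_mem_closure_permHat_eq Tp w hT
  have hw := hPBF (ZMod n) (Subgroup.closure Tp) w hQ
  have hletters : {s : ZMod n | ∀ σ ∈ Subgroup.closure Tp, σ s = s} ⊆
      {i | ∀ t ∈ T, (t.1 : ZMod n) * i + t.2 = i} := by
    intro s hs t ht
    have h := hs (affPerm n t.1 t.2) (Subgroup.subset_closure ⟨t, ht, rfl⟩)
    simpa using h
  have hmono : (Subgroup.closure (FreeGroup.of '' {s : ZMod n | ∀ σ ∈ Subgroup.closure Tp, σ s = s}) :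
      Set (FreeGroup (ZMod n))) ⊆
      (Subgroup.closure (FreeGroup.of '' {i : ZMod n | ∀ t ∈ T, (t.1 : ZMod n) * i + t.2 = i}) : Set _) :=
    Subgroup.closure_mono (Set.image_mono hletters)
  have hw' := closure_mono (Set.image_mono hmono) hw
  have himg := image_closure_subset_closure_image (iota n).continuous ⟨w, hw', rfl⟩
  refine closure_mono ?_ himg
  rintro _ ⟨_, ⟨g, hg, rfl⟩, rfl⟩
  exact ⟨SemidirectProduct.inl g, ⟨g, hg, rfl⟩, (iota_toCompletion n g).symm⟩

/-- **Decomposition lemma.** If `q ∈ Q_n` has `q⁻¹ · k̂_{u_j,β_j}(q) ∈ η_Λ(C_n)` for a family of affine maps, then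
`q = ν″ · η_Λ(c)` with `ν″ ∈ N̂` EXACTLY fixed by every `k̂_{u_j,β_j}`. [cite: MochizukiEtTh2009, §1 p.12] -/
theorem exists_decomp_fixed {J : Type*} (u β : J → ZMod n) (q : Q n)
    (hq : ∀ j, ∃ d : Multiplicative (ZMod n), q⁻¹ * affHat n (u j) (β j) q = etaL n (SemidirectProduct.inr d)) :
    ∃ (ν'' : Q n) (c : Multiplicative (ZMod n)), ν'' ∈ NhatSub n ∧
      q = ν'' * etaL n (SemidirectProduct.inr c) ∧ ∀ j, affHat n (u j) (β j) ν'' = ν'' := by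
  haveI : (Glet n).FiniteIndex := finiteIndex_Glet n
  obtain ⟨f, hf⟩ := Literature.IUT.HodgeTheaters.ProfiniteCompletion.exists_inv_mul_mem_closure (Glet n) q
  set c := f.right with hc
  set ν'' := q * (etaL n (SemidirectProduct.inr c))⁻¹ with hν''
  have hν''mem : ν'' ∈ NhatSub n := by
    have hμ : (etaL n f)⁻¹ * q ∈ NhatSub n := by
      rw [← SetLike.mem_coe, coe_NhatSub]; exact hf
    have hf' : etaL n f = etaL n (SemidirectProduct.inl f.left) * etaL n (SemidirectProduct.inr c) := by
      rw [← map_mul, hc, SemidirectProduct.inl_left_mul_inr_right]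
    have hconj : etaL n (SemidirectProduct.inr c) * ((etaL n f)⁻¹ * q) * (etaL n (SemidirectProduct.inr c))⁻¹
        ∈ NhatSub n := by
      have h := conj_inr_mem_NhatSub n c⁻¹ hμ
      simpa only [map_inv, inv_inv] using h
    have heq : ν'' = etaL n (SemidirectProduct.inl f.left) *
        (etaL n (SemidirectProduct.inr c) * ((etaL n f)⁻¹ * q) * (etaL n (SemidirectProduct.inr c))⁻¹) := by
      rw [hν'', hf']; group
    rw [heq]
    exact (NhatSub n).mul_mem (etaL_inl_mem_NhatSub n f.left) hconj
  have hqdec : q = ν'' * etaL n (SemidirectProduct.inr c) := by rw [hν'']; group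
  obtain ⟨π, hπη, hπN, hπaff⟩ := exists_projC n
  refine ⟨ν'', c, hν''mem, hqdec, fun j => ?_⟩
  obtain ⟨d, hd⟩ := hq j
  have h2 : affHat n (u j) (β j) q =
      affHat n (u j) (β j) ν'' * etaL n (SemidirectProduct.inr (affRot n (u j) c)) := by
    rw [hqdec, map_mul, affHat_etaL, aff_inr]
  have h3 := hd
  rw [h2] at h3
  rw [hqdec] at h3
  have h4 : ν''⁻¹ * affHat n (u j) (β j) ν'' =
      etaL n (SemidirectProduct.inr c) * etaL n (SemidirectProduct.inr d) *
        (etaL n (SemidirectProduct.inr (affRot n (u j) c)))⁻¹ := by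
    rw [← h3]; group
  have h1 : ν''⁻¹ * affHat n (u j) (β j) ν'' =
      etaL n (SemidirectProduct.inr (c * d * (affRot n (u j) c)⁻¹)) := by
    rw [h4, map_mul, map_mul, map_mul, map_mul, map_inv, map_inv]
  have h5 : c * d * (affRot n (u j) c)⁻¹ = 1 := by
    have h6 := congrArg π h1
    rw [map_mul, map_inv, hπaff, hπN ν'' hν''mem, map_one, inv_one, one_mul, hπη,
      SemidirectProduct.rightHom_inr] at h6
    exact h6.symm
  have h7 : ν''⁻¹ * affHat n (u j) (β j) ν'' = 1 := by rw [h1, h5, map_one, map_one]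
  rw [inv_mul_eq_one] at h7
  exact h7.symm

end AffineTools

end Literature.AnabelianGeometry.EtaleTheta.SettingModel.BTorsionTower

end
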